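import Summits.CriticalPhenomena.Ising3D.Control2DL15TwoSided0975
import Summits.CriticalPhenomena.Ising3D.Control2DL19GapC
import Mathlib.Tactic.NormNum
import HarnessLib

/-!
# The first Λ = 19 piece of the class-1 2D statement in the kernel: `0.975 < Δ_ε < 1.00005` at `Δ_σ = 1/8` under `A2D′`, no window
(cell `pub-ising3x`, seat controls-1 gen 19; KERNEL PATH for the 2D γ-certificates, Λ ≤ 19 class-1 cover — CONTROL-ONLY)

HONEST FRAMING: lottery ticket; floor = tightest certified 3D Ising CFT bounds; no exact-solution
claim without a proof. CONTROL-ONLY (`d = 2`, `Δ_σ = 1/8`, axiom set `A2D′`); nothing about `d = 3`; still weaker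
than the reader-certified statement of record (`0.99 < Δ_ε < 1.00005`, Λ = 19, readers A ∧ B) on the LOWER side.

The RB-5 Λ = 19 / E₀ = 48 gap certificate `j129766` (`Δ_ε < 20001/20000`; truncations `Nd = 71` at spins 0–10,
`63` at 12–16, `47` at 18–46; `Control2DL19GapC`, the first Λ = 19 γ-certificate replayed in the kernel) replaces the
Λ = 15 gap `10001/10000` on top of the landed Λ = 15 box cover `excludedOn_2d_cover0975`:
* `twoSided_2d_kernel0975u (w) : TwoSided (1/8) 2 1 w (39/40) (20001/20000)` for EVERY real `w` — under `A2D′` at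
  `Δ_σ = 1/8`: `0.975 < Δ_ε < 1.00005` (2D Ising: `Δ_ε = 1`); the upper edge is now the reader-certified one of
  record (`cover_v15.json`), resting on the Lean kernel alone. A further instance for the C-C ledger
  (`Control2DConjectureCC`: `εlo = 39/40 < 1 < U = 20001/20000`). No facts, standard axioms only.
-/

namespace Summit.CriticalPhenomena.Ising3D.Control2D

open Set
open Literature.MathematicalPhysics.QuantumFieldTheory.ConformalBootstrap3D

/-- **2D control, class 1, kernel-complete, Λ = 19 upper edge — for EVERY window parameter `w`**: under `A2D′` at
`Δ_σ = 1/8` the `ε` location satisfies `39/40 < Δ_ε < 20001/20000`. CONTROL-ONLY (d = 2).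
[cite: RattazziEtAl2008, §5.5] -/
theorem twoSided_2d_kernel0975u (w : ℝ) : TwoSided (1 / 8 : ℝ) 2 1 w (39 / 40) (20001 / 20000) :=
  twoSided_of_cover_zero excludedOn_2d_cover0975 gapExcluded_2d_L19_gapC (by norm_num) w

end Summit.CriticalPhenomena.Ising3D.Control2D
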